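import Summits.QuantumFields.YangMills.Theorems.BalabanUVNodesN21LowCentreEndAtSUNBlockChartPackageCoercive
import Summits.QuantumFields.YangMills.Theorems.BalabanUVNodesN21TorusBoxCombGaugePoincare

/-!
# N21 (NE7c) · THE [LF-II] §1-LETTERS END ON THE EXPONENTIAL `SU(N)` BLOCK CHART, XII: file 20's per-fibre CHART PACKAGE ∕ (M1) ENDs with `h19`
# from the (1.7) row IN TORUS LETTERS, for EVERY block `b` of box bonds off the axial comb of a non-wrapping torus box — junction №5's own letters
# `hbox ∕ hcomb`, no `ℤ^d` object displayed: dag-n21-w3 g6's `…TorusBoxCombGaugePoincare.ineq19_blockChartSU_of_ineq17_torus` (p642865) supplies it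

Width seat pub-ymgap-dag-n21-w1 (g5; director-ym №197 ∕ HUMAN RULING D-0149), node N21 = NE7c (NOT PRINTED in [Bałaban 1983–89], NOT proved), lane K3⁸
`SpineGivenEndpointR13SepCoPHV` (stmt-QuantumFields-27366, KEY MAP v2; lineage K3⁷ 20544), `--kind proof --supports … --as helper`.  File 34 of the seat's chain —
the torus-letter edition of files 30 (`…CoerciveBox`, p639454) and 31 (`…CoerciveAxialComb`, p641146), which dag-n21-w3 g6 worded «one-token re-knits of your packages
are yours if wanted» (bus 2026-08-28 14:54Z, FILED-24).  THEOREMS ONLY: 0 `def`, 0 `sorry`; count-neutral.  Imports file 20 `…PackageCoercive` (p621358) and dag-n21-w3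
g6's `…N21TorusBoxCombGaugePoincare` (p642865).  NO Theses import.  Restates nothing; composes BY NAME.

WHY THIS EDITION.  Junction №5 (dag-n21-w2's tree-gauge road) and file 22 §1b quantify over blocks `b` of TORUS box bonds in the COMB gauge of a non-wrapping box
`[lo, hi]`, with exactly the letters `hbox : ∀ i ∈ b, i ∈ boxBonds lo hi` and `hcomb : ∀ i ∈ b, i ∉ combBonds lo hi`; files 30∕31 asked instead for a `ℤ^d` box `(n, y)` with
`castBond` injective and the block PINNED to an image (`hbdef`), and read the (1.7) row against the `ℤ^d` circulation of a pull-back.  Here the (1.7) row is read against the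
TORUS curl energy `Σ_{p ∈ S_p} Σ_a |(curl 1 v̄)(p)_a|²` of the zero-extension `v̄` of the chart vector (any finset `S_p ⊇ boxPlaqs lo hi`) — the currency of NODE O's flat
Hessian identity — and the block is ANY `b` with `hbox ∕ hcomb`: the consumer's statement carries no `ℤ^d` vocabulary at all.

WHAT IS PROVED ([bookkeeping]: one `exact` each — file 20's three theorems with `h19 := ineq19_blockChartSU_of_ineq17_torus hwrap M hd hsides hM b hbox hcomb Qf hγ₀.le Sp hSp h17 hsmall`;
displayed instead of `h19`: the non-wrapping clause `hwrap : ∀ κ, hi κ − lo κ < sitesPerDir`, the sides `hsides : ∀ κ, hi κ + 1 − lo κ ≤ 100M`, `1 ≤ M`, `hbox`, `hcomb`, `S_p ⊇ boxPlaqs`,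
the (1.7) row `h17` in torus letters and the smallness line `hsmall`).
* ★ `chartAC_of_sect1Letters_analyticLocal_of_ineq17_torus` · ★ `cutChartLawAC_of_sect1Letters_analyticLocal_of_ineq17_torus` ·
  ★★ `chartPackage_of_sect1Letters_analyticLocal_of_ineq17_torus`.

A6 (director-ym №189 (3)).  The displayed binders are the UNION of (i) file 20's §1-letter ∕ statistic ∕ envelope ∕ odds binders and clauses — inhabited at
the one-bond block by file 16's `cutChartLawAnalytic_binders_inhabited` and file 13's `cutChartLaw_dressed_binders_inhabited_sharp` (kernel witnesses, `Qf` a multiple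
of `Σ‖v b′‖²`) — and (ii) dag-n21-w3 g6's torus letters `hwrap ∕ hsides ∕ hbox ∕ hcomb ∕ hSp ∕ h17 ∕ hsmall`, inhabited for EVERY non-wrapping box and block off its comb at
`Qf :=` the torus curl energy, `γ₀ = 1`, `Cc = 0` by their `ineq17_torus_binders_inhabited` (p642865 §A6; `hcomb` cannot be dropped: `ineq18_torus_void_without_combGauge`).
A JOINT kernel witness at one concrete torus box is not typed in this file (the two binder families share only `b`, `M`, `d`, `γ₀` and `Qf`); this is said here so the
referee can grade the knit accordingly.

HONEST FRAMING.  Composition BY NAME of landed files (dag-n21-w3 g6's §3∕§4 credited); the (1.7) row `h17` (about Bałaban's `Δ₁(ζ₀)`), the dressed presentation `hR`, the (1.2)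
expansion's identification, the analyticity letter, the statistic binders, the odds and the clauses remain the consumer's HYPOTHESES (NODE O's term object ∕ located letters); which
box ∕ comb ∕ block the (M1) package uses is the measure side's decision (dag-n21-w2 ∕ dag-n21-d; junction №5); nothing of Bałaban's asserted; (M1) ∕ NE7c NOT PRINTED ∕ NOT proved;
**N21 NOT discharged**; K3⁸ NOT claimed; counts unmoved (typed 28∕28 · discharged 5∕27); never a count claim; one finite 𝕋⁴ at fixed ε — R4 would close only the conditional
finite-𝕋⁴ rung `BalabanLadder.UV`, NOT the Yang–Mills mass gap (Clay); nothing about ℝ⁴ ∕ OS.  No decl below carries a cite tag.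
-/

set_option autoImplicit false

noncomputable section

open MeasureTheory Set Function Finset Metric
open scoped ENNReal BigOperators Matrix

namespace Summit.QuantumFields.YangMills.Theorems.N21LowCentreEndAtSUNBlockChartPackageCoerciveTorusComb

open Literature.MathematicalPhysics.QuantumFieldTheory.Balaban1983to89
open Literature.MathematicalPhysics.QuantumFieldTheory.Balaban1983to89.T4Continuum
open Literature.MathematicalPhysics.QuantumFieldTheory.Balaban1983to89.Node00 hiding dimSU
open Literature.MathematicalPhysics.QuantumFieldTheory.Balaban1983to89.T4ShellMeasure (SlotAntiConcentration)
open Literature.MathematicalPhysics.QuantumFieldTheory.Balaban1983to89.T4ShellMeasureDet (blockLaw)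
open Literature.MathematicalPhysics.QuantumFieldTheory.Balaban1983to89.B16Sect1Wilson (Ineq16 Ineq17 Ineq19)
open Literature.MathematicalPhysics.QuantumFieldTheory.Balaban1983to89.LatticeFieldCalculus (curl)
open Summit.QuantumFields.BalabanUV.T4Continuum
open Summit.QuantumFields.BalabanUV.T4Continuum.ShellMeasureExpChartSUN (SUN ChartSU BlockChartSU dimSU expFibreChartSU chartWeightSU)
open Summit.QuantumFields.BalabanUV.T4Continuum.ShellMeasureScalingSUN (windowSU)
open Summit.QuantumFields.BalabanUV.T4Continuum.ShellMeasureExpJacobianSUN (expJacWeightSU)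
open Summit.QuantumFields.BalabanUV.T4Continuum.ShellMeasureExpHaarAreaSUN (kappaSU)
open Summit.QuantumFields.BalabanUV.T4Continuum.ShellMeasureExpDuhamelSUN (duhT)
open Summit.QuantumFields.YangMills.Theorems.N21ShellSplitOfRecord13CoPH (blockReading)
open Summit.QuantumFields.YangMills.Theorems.N21LowCentreEndAtSUNBlockChartAnalytic
  (cutChartLawAC_of_sect1Letters_analyticLocal chartAC_of_sect1Letters_analyticLocal)
open Summit.QuantumFields.YangMills.Theorems.N21LowCentreEndAtSUNBlockChartPackage (chartPackage_of_sect1Letters_analyticLocal)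
open Literature.MathematicalPhysics.QuantumFieldTheory.Balaban1983to89.T4AxialGaugeSmallField (boxBonds boxPlaqs)
open Literature.MathematicalPhysics.QuantumFieldTheory.Balaban1983to89.T4AxialGaugeFixing (combBonds)
open Summit.QuantumFields.YangMills.Theorems.N21TorusBoxCombGaugePoincare (ineq19_blockChartSU_of_ineq17_torus)

variable {N : ℕ} [NeZero N] {P : Params} {j : ℕ} {lo hi : Fin P.d → ℤ}

/-- ★ **THE (M1) END AT A BLOCK STATISTIC READ IN THE CHART, `h19` FROM THE (1.7) ROW IN TORUS LETTERS** — file 20's ★ for ANY block `b` of box bonds off the axial comb of a non-wrapping torus box `[lo, hi]` (letters `hbox`, `hcomb`; sides `≤ 100M`, `1 ≤ M`), the (1.7) row read against the torus curl energy of the zero-extension of the chart vector over any `S_p ⊇ boxPlaqs lo hi`, and `h19` produced by dag-n21-w3 g6's `ineq19_blockChartSU_of_ineq17_torus`. [bookkeeping] -/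
theorem chartAC_of_sect1Letters_analyticLocal_of_ineq17_torus (hN : 2 ≤ N) (b : Finset (PBond P j)) (hb : b.Nonempty)
    {S : ℝ} (hS : 0 < S) (hSπ : S < Real.pi) (c : GaugeField P j (SU N)) (R : (↥b → SU N) → ℝ≥0∞)
    (u : GaugeField P j (SU N) → ℝ) (x : GaugeField P j (SU N))
    (K₀ : Set (BlockChartSU N b)) (A Qf lin Vt : BlockChartSU N b → ℝ)
    (hAm : Measurable fun z : BlockChartSU N b => K₀.indicator (fun w => ENNReal.ofReal (Real.exp (-A w))) z)
    {U : BlockChartSU N b → ℝ} (hUm : Measurable U)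
    {C Env : Set (BlockChartSU N b)} (hC : MeasurableSet C) (hEnv : MeasurableSet Env)
    {θ ρ σ κ₀ Q L γ₀ B₃ M₀ A₀ p₀g Rk WV r S₂ Cc εk : ℝ} (M : ℕ)
    (hθ : 0 < θ) (hρ0 : 0 < ρ) (hρ1 : ρ < 1) (hρσ : ρ + σ ≤ 1) (hκ : 0 < κ₀) (hQ0 : 0 ≤ Q) (hL : 0 < L)
    (hd : 1 ≤ P.d) (hM : 1 ≤ M) (hγ₀ : 0 < γ₀) (hr : 0 < r)
    (hW : 0 ≤ 3 * B₃ * M₀ * A₀ ^ 2 * p₀g ^ 2 * Real.exp (-Rk) * (100 * (M : ℝ)) ^ 4 + WV)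
    (hK₀ : Convex ℝ K₀) (h0K₀ : (0 : BlockChartSU N b) ∈ K₀)
    (hexp : ∀ v ∈ K₀, A v = A 0 + 1 / 2 * Qf v + lin v + Vt v)
    (Mq : Matrix (↥b × Fin (dimSU N)) (↥b × Fin (dimSU N)) ℝ)
    (hQf : ∀ v, Qf v = (fun q : ↥b × Fin (dimSU N) => v q.1 q.2) ⬝ᵥ (Mq *ᵥ fun q => v q.1 q.2))
    -- the (1.7) row IN TORUS LETTERS on a block `b` of box bonds off the comb of the non-wrapping box `[lo, hi]`, replacing `h19`
    (hwrap : ∀ κ, hi κ - lo κ < P.sitesPerDir j) (hsides : ∀ κ, hi κ + 1 - lo κ ≤ 100 * M)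
    (hbox : ∀ i ∈ b, i ∈ (boxBonds lo hi : Set (PBond P j)))
    (hcomb : ∀ i ∈ b, i ∉ (combBonds lo hi : Finset (PBond P j)))
    (Sp : Finset (Plaq P j)) (hSp : (boxPlaqs lo hi : Set (Plaq P j)) ⊆ ↑Sp)
    (h17 : ∀ v : BlockChartSU N b, Ineq17 (Qf v)
      (∑ p ∈ Sp, ∑ a : Fin (dimSU N),
        curl 1 (fun (bd : PBond P j) (a' : Fin (dimSU N)) => if h : bd ∈ b then v ⟨bd, h⟩ a' else (0 : ℝ)) p a ^ 2)
      (∑ i, ‖v i‖ ^ 2) γ₀ Cc M Rk εk)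
    (hsmall : Cc * ((M : ℝ) ^ 6 * Rk * εk + Real.exp (-Rk)) ≤ γ₀ / (2 * P.d * (100 * (M : ℝ)) ^ (P.d + 1)))
    (ℓ : BlockChartSU N b →ₗ[ℝ] ℝ) (hlin : ∀ v, lin v = ℓ v)
    (h16 : ∀ v ∈ K₀, Ineq16 (lin v) B₃ M₀ A₀ p₀g Rk M)
    (hV : ∀ v ∈ K₀, |Vt v| ≤ WV)
    (Φ : (↥b × Fin (dimSU N) → ℂ) → ℂ)
    (hVt : ∀ x ∈ K₀, Vt x = (Φ fun q => ((x q.1 q.2 : ℝ) : ℂ)).re)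
    (hΦd : ∀ x ∈ K₀, DifferentiableOn ℂ Φ (ball (fun q => ((x q.1 q.2 : ℝ) : ℂ)) r))
    (hΦS : ∀ x ∈ K₀, ∀ u ∈ ball (fun q : ↥b × Fin (dimSU N) => ((x q.1 q.2 : ℝ) : ℂ)) r, ‖Φ u‖ ≤ S₂)
    (hclause₂ : 4 * P.d * (100 * (M : ℝ)) ^ (P.d + 1) * S₂ ≤ γ₀ * r ^ 2)
    (hUL : ∀ z z' : BlockChartSU N b, U z - U z' ≤ L * ‖z - z'‖)
    (hUc : U 0 ≤ σ * θ)
    (hclause : 16 * (3 * B₃ * M₀ * A₀ ^ 2 * p₀g ^ 2 * Real.exp (-Rk) * (100 * (M : ℝ)) ^ 4 +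
        (WV + b.card * ((N * N : ℕ) * (-2 * Real.log (Real.sinc S))))) * P.d
      * (100 * (M : ℝ)) ^ (P.d + 1) * (dimSU N * L ^ 2) ≤ γ₀ * (θ * (1 - ρ - σ)) ^ 2)
    (henv : ∀ l ∈ Icc (1 - 1 / ((b.card : ℝ) * dimSU N + 1)) 1, ∀ z : BlockChartSU N b,
      θ * (1 - ρ) ≤ U z → U z < θ → z ∈ C → l • z ∈ Env)
    (hRT : ∀ z : BlockChartSU N b, θ * (1 - ρ) ≤ U z → U z < θ → z ∈ C → ∀ s' : ℝ, 1 ≤ s' →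
      θ * (1 - ρ) ≤ U (s' • z) → U (s' • z) < θ → s' • z ∈ C → U z + κ₀ * (θ * (1 - ρ)) * (s' - 1) ≤ U (s' • z))
    (hQ : ((volume : Measure (BlockChartSU N b)).withDensity fun z =>
        chartWeightSU b S (expJacWeightSU (kappaSU N)) z * K₀.indicator (fun w => ENNReal.ofReal (Real.exp (-A w))) z)
          (Env \ ({z | U z < θ} ∩ C))
      ≤ ENNReal.ofReal Q * ((volume : Measure (BlockChartSU N b)).withDensity fun z =>
        chartWeightSU b S (expJacWeightSU (kappaSU N)) z * K₀.indicator (fun w => ENNReal.ofReal (Real.exp (-A w))) z)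
          ({z | U z < θ} ∩ C))
    (hR : ∀ z ∈ closedBall (0 : BlockChartSU N b) S, R (expFibreChartSU b c z) =
      ({z | U z < θ} ∩ C).indicator (fun z' => K₀.indicator (fun w => ENNReal.ofReal (Real.exp (-A w))) z') z)
    (hread : ∀ z ∈ closedBall (0 : BlockChartSU N b) S, blockReading N u b x (expFibreChartSU b c z) = U z) :
    SlotAntiConcentration ((volume : Measure (BlockChartSU N b)).withDensity fun z =>
        chartWeightSU b S (expJacWeightSU (kappaSU N)) z * R (expFibreChartSU b c z))
      (blockReading N u b x ∘ expFibreChartSU b c) θ ρ (3 * ((b.card : ℝ) * dimSU N + 1) * (1 + Q) / (κ₀ * (1 - ρ))) := by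
  exact chartAC_of_sect1Letters_analyticLocal hN b hb hS hSπ c R u x K₀ A Qf lin Vt hAm hUm hC hEnv hθ hρ0 hρ1 hρσ hκ hQ0 hL hd
    (by exact_mod_cast (hM : 0 < M)) hγ₀ hr hW hK₀ h0K₀ hexp Mq hQf
    (ineq19_blockChartSU_of_ineq17_torus hwrap M hd hsides hM b hbox hcomb Qf hγ₀.le Sp hSp h17 hsmall)
    ℓ hlin h16 hV Φ hVt hΦd hΦS hclause₂ hUL hUc hclause henv hRT hQ hR hread

/-- ★ **THE CUT-CHART-LAW (M1), `h19` FROM THE (1.7) ROW IN TORUS LETTERS** — file 20's ★ for any block `b` off the comb of a non-wrapping box (`hbox`, `hcomb`) and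
`ineq19_blockChartSU_of_ineq17_torus`. [bookkeeping] -/
theorem cutChartLawAC_of_sect1Letters_analyticLocal_of_ineq17_torus (hN : 2 ≤ N) (b : Finset (PBond P j)) (hb : b.Nonempty)
    {S : ℝ} (hS : 0 < S) (hSπ : S < Real.pi)
    (K₀ : Set (BlockChartSU N b)) (A Qf lin Vt : BlockChartSU N b → ℝ)
    (hAm : Measurable fun z : BlockChartSU N b => K₀.indicator (fun w => ENNReal.ofReal (Real.exp (-A w))) z)
    {U : BlockChartSU N b → ℝ} (hUm : Measurable U)
    {C Env : Set (BlockChartSU N b)} (hC : MeasurableSet C) (hEnv : MeasurableSet Env)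
    {θ ρ σ κ₀ Q L γ₀ B₃ M₀ A₀ p₀g Rk WV r S₂ Cc εk : ℝ} (M : ℕ)
    (hθ : 0 < θ) (hρ0 : 0 < ρ) (hρ1 : ρ < 1) (hρσ : ρ + σ ≤ 1) (hκ : 0 < κ₀) (hQ0 : 0 ≤ Q) (hL : 0 < L)
    (hd : 1 ≤ P.d) (hM : 1 ≤ M) (hγ₀ : 0 < γ₀) (hr : 0 < r)
    (hW : 0 ≤ 3 * B₃ * M₀ * A₀ ^ 2 * p₀g ^ 2 * Real.exp (-Rk) * (100 * (M : ℝ)) ^ 4 + WV)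
    (hK₀ : Convex ℝ K₀) (h0K₀ : (0 : BlockChartSU N b) ∈ K₀)
    (hexp : ∀ v ∈ K₀, A v = A 0 + 1 / 2 * Qf v + lin v + Vt v)
    (Mq : Matrix (↥b × Fin (dimSU N)) (↥b × Fin (dimSU N)) ℝ)
    (hQf : ∀ v, Qf v = (fun q : ↥b × Fin (dimSU N) => v q.1 q.2) ⬝ᵥ (Mq *ᵥ fun q => v q.1 q.2))
    -- the (1.7) row IN TORUS LETTERS on a block `b` of box bonds off the comb of the non-wrapping box `[lo, hi]`, replacing `h19`
    (hwrap : ∀ κ, hi κ - lo κ < P.sitesPerDir j) (hsides : ∀ κ, hi κ + 1 - lo κ ≤ 100 * M)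
    (hbox : ∀ i ∈ b, i ∈ (boxBonds lo hi : Set (PBond P j)))
    (hcomb : ∀ i ∈ b, i ∉ (combBonds lo hi : Finset (PBond P j)))
    (Sp : Finset (Plaq P j)) (hSp : (boxPlaqs lo hi : Set (Plaq P j)) ⊆ ↑Sp)
    (h17 : ∀ v : BlockChartSU N b, Ineq17 (Qf v)
      (∑ p ∈ Sp, ∑ a : Fin (dimSU N),
        curl 1 (fun (bd : PBond P j) (a' : Fin (dimSU N)) => if h : bd ∈ b then v ⟨bd, h⟩ a' else (0 : ℝ)) p a ^ 2)
      (∑ i, ‖v i‖ ^ 2) γ₀ Cc M Rk εk)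
    (hsmall : Cc * ((M : ℝ) ^ 6 * Rk * εk + Real.exp (-Rk)) ≤ γ₀ / (2 * P.d * (100 * (M : ℝ)) ^ (P.d + 1)))
    (ℓ : BlockChartSU N b →ₗ[ℝ] ℝ) (hlin : ∀ v, lin v = ℓ v)
    (h16 : ∀ v ∈ K₀, Ineq16 (lin v) B₃ M₀ A₀ p₀g Rk M)
    (hV : ∀ v ∈ K₀, |Vt v| ≤ WV)
    (Φ : (↥b × Fin (dimSU N) → ℂ) → ℂ)
    (hVt : ∀ x ∈ K₀, Vt x = (Φ fun q => ((x q.1 q.2 : ℝ) : ℂ)).re)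
    (hΦd : ∀ x ∈ K₀, DifferentiableOn ℂ Φ (ball (fun q => ((x q.1 q.2 : ℝ) : ℂ)) r))
    (hΦS : ∀ x ∈ K₀, ∀ u ∈ ball (fun q : ↥b × Fin (dimSU N) => ((x q.1 q.2 : ℝ) : ℂ)) r, ‖Φ u‖ ≤ S₂)
    (hclause₂ : 4 * P.d * (100 * (M : ℝ)) ^ (P.d + 1) * S₂ ≤ γ₀ * r ^ 2)
    (hUL : ∀ z z' : BlockChartSU N b, U z - U z' ≤ L * ‖z - z'‖)
    (hUc : U 0 ≤ σ * θ)
    (hclause : 16 * (3 * B₃ * M₀ * A₀ ^ 2 * p₀g ^ 2 * Real.exp (-Rk) * (100 * (M : ℝ)) ^ 4 +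
        (WV + b.card * ((N * N : ℕ) * (-2 * Real.log (Real.sinc S))))) * P.d
      * (100 * (M : ℝ)) ^ (P.d + 1) * (dimSU N * L ^ 2) ≤ γ₀ * (θ * (1 - ρ - σ)) ^ 2)
    (henv : ∀ l ∈ Icc (1 - 1 / ((b.card : ℝ) * dimSU N + 1)) 1, ∀ z : BlockChartSU N b,
      θ * (1 - ρ) ≤ U z → U z < θ → z ∈ C → l • z ∈ Env)
    (hRT : ∀ z : BlockChartSU N b, θ * (1 - ρ) ≤ U z → U z < θ → z ∈ C → ∀ s' : ℝ, 1 ≤ s' →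
      θ * (1 - ρ) ≤ U (s' • z) → U (s' • z) < θ → s' • z ∈ C → U z + κ₀ * (θ * (1 - ρ)) * (s' - 1) ≤ U (s' • z))
    (hQ : ((volume : Measure (BlockChartSU N b)).withDensity fun z =>
        chartWeightSU b S (expJacWeightSU (kappaSU N)) z * K₀.indicator (fun w => ENNReal.ofReal (Real.exp (-A w))) z)
          (Env \ ({z | U z < θ} ∩ C))
      ≤ ENNReal.ofReal Q * ((volume : Measure (BlockChartSU N b)).withDensity fun z =>
        chartWeightSU b S (expJacWeightSU (kappaSU N)) z * K₀.indicator (fun w => ENNReal.ofReal (Real.exp (-A w))) z)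
          ({z | U z < θ} ∩ C)) :
    SlotAntiConcentration
      (((volume : Measure (BlockChartSU N b)).withDensity fun z => (K₀ ∩ closedBall (0 : BlockChartSU N b) S).indicator
        (fun w => ENNReal.ofReal (Real.exp (-(A w +
          (∑ i, -Real.log (LinearMap.det (duhT (w i) : ChartSU N →ₗ[ℝ] ChartSU N))) -
            b.card * Real.log (kappaSU N).toReal)))) z).restrict ({z | U z < θ} ∩ C))
      U θ ρ (3 * ((b.card : ℝ) * dimSU N + 1) * (1 + Q) / (κ₀ * (1 - ρ))) := by
  exact cutChartLawAC_of_sect1Letters_analyticLocal hN b hb hS hSπ K₀ A Qf lin Vt hAm hUm hC hEnv hθ hρ0 hρ1 hρσ hκ hQ0 hL hd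
    (by exact_mod_cast (hM : 0 < M)) hγ₀ hr hW hK₀ h0K₀ hexp Mq hQf
    (ineq19_blockChartSU_of_ineq17_torus hwrap M hd hsides hM b hbox hcomb Qf hγ₀.le Sp hSp h17 hsmall)
    ℓ hlin h16 hV Φ hVt hΦd hΦS hclause₂ hUL hUc hclause henv hRT hQ

/-- ★★ **THE PER-FIBRE CHART PACKAGE OF THE KEYED ∕ TREE-GAUGE KNITS, `h19` FROM THE (1.7) ROW IN TORUS LETTERS** — file 20's ★★ for any block `b` off the
comb of a non-wrapping box (junction №5's `hbox`, `hcomb`) and `ineq19_blockChartSU_of_ineq17_torus`. [bookkeeping] -/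
theorem chartPackage_of_sect1Letters_analyticLocal_of_ineq17_torus (hN : 2 ≤ N) (b : Finset (PBond P j)) (hb : b.Nonempty)
    (μ : Measure (↥b → SU N)) {S : ℝ} (hS : 0 < S) (hSπ : S < Real.pi) (c : GaugeField P j (SU N))
    {R : (↥b → SU N) → ℝ≥0∞} (hRm : Measurable R)
    (hlaw : μ = (blockLaw b).withDensity fun y => windowSU b c S y * R y)
    (v : (↥b → SU N) → ℝ)
    (K₀ : Set (BlockChartSU N b)) (A Qf lin Vt : BlockChartSU N b → ℝ)
    (hAm : Measurable fun z : BlockChartSU N b => K₀.indicator (fun w => ENNReal.ofReal (Real.exp (-A w))) z)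
    {U : BlockChartSU N b → ℝ} (hUm : Measurable U)
    {C Env : Set (BlockChartSU N b)} (hC : MeasurableSet C) (hEnv : MeasurableSet Env)
    {θ ρ σ κ₀ Q L γ₀ B₃ M₀ A₀ p₀g Rk WV DK r S₂ Cc εk : ℝ} (M : ℕ)
    (hθ : 0 < θ) (hρ0 : 0 < ρ) (hρ1 : ρ < 1) (hρσ : ρ + σ ≤ 1) (hκ : 0 < κ₀) (hQ0 : 0 ≤ Q) (hL : 0 < L)
    (hd : 1 ≤ P.d) (hM : 1 ≤ M) (hγ₀ : 0 < γ₀) (hr : 0 < r)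
    (hW : 0 ≤ 3 * B₃ * M₀ * A₀ ^ 2 * p₀g ^ 2 * Real.exp (-Rk) * (100 * (M : ℝ)) ^ 4 + WV)
    (hK₀ : Convex ℝ K₀) (h0K₀ : (0 : BlockChartSU N b) ∈ K₀)
    (hexp : ∀ w ∈ K₀, A w = A 0 + 1 / 2 * Qf w + lin w + Vt w)
    (Mq : Matrix (↥b × Fin (dimSU N)) (↥b × Fin (dimSU N)) ℝ)
    (hQf : ∀ w, Qf w = (fun q : ↥b × Fin (dimSU N) => w q.1 q.2) ⬝ᵥ (Mq *ᵥ fun q => w q.1 q.2))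
    -- the (1.7) row IN TORUS LETTERS on a block `b` of box bonds off the comb of the non-wrapping box `[lo, hi]`, replacing `h19`
    (hwrap : ∀ κ, hi κ - lo κ < P.sitesPerDir j) (hsides : ∀ κ, hi κ + 1 - lo κ ≤ 100 * M)
    (hbox : ∀ i ∈ b, i ∈ (boxBonds lo hi : Set (PBond P j)))
    (hcomb : ∀ i ∈ b, i ∉ (combBonds lo hi : Finset (PBond P j)))
    (Sp : Finset (Plaq P j)) (hSp : (boxPlaqs lo hi : Set (Plaq P j)) ⊆ ↑Sp)
    (h17 : ∀ w : BlockChartSU N b, Ineq17 (Qf w)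
      (∑ p ∈ Sp, ∑ a : Fin (dimSU N),
        curl 1 (fun (bd : PBond P j) (a' : Fin (dimSU N)) => if h : bd ∈ b then w ⟨bd, h⟩ a' else (0 : ℝ)) p a ^ 2)
      (∑ i, ‖w i‖ ^ 2) γ₀ Cc M Rk εk)
    (hsmall : Cc * ((M : ℝ) ^ 6 * Rk * εk + Real.exp (-Rk)) ≤ γ₀ / (2 * P.d * (100 * (M : ℝ)) ^ (P.d + 1)))
    (ℓ : BlockChartSU N b →ₗ[ℝ] ℝ) (hlin : ∀ w, lin w = ℓ w)
    (h16 : ∀ w ∈ K₀, Ineq16 (lin w) B₃ M₀ A₀ p₀g Rk M)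
    (hV : ∀ w ∈ K₀, |Vt w| ≤ WV)
    (Φ : (↥b × Fin (dimSU N) → ℂ) → ℂ)
    (hVt : ∀ x ∈ K₀, Vt x = (Φ fun q => ((x q.1 q.2 : ℝ) : ℂ)).re)
    (hΦd : ∀ x ∈ K₀, DifferentiableOn ℂ Φ (ball (fun q => ((x q.1 q.2 : ℝ) : ℂ)) r))
    (hΦS : ∀ x ∈ K₀, ∀ u ∈ ball (fun q : ↥b × Fin (dimSU N) => ((x q.1 q.2 : ℝ) : ℂ)) r, ‖Φ u‖ ≤ S₂)
    (hclause₂ : 4 * P.d * (100 * (M : ℝ)) ^ (P.d + 1) * S₂ ≤ γ₀ * r ^ 2)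
    (hR : ∀ z ∈ closedBall (0 : BlockChartSU N b) S, R (expFibreChartSU b c z) =
      ({z | U z < θ} ∩ C).indicator (fun z' => K₀.indicator (fun w => ENNReal.ofReal (Real.exp (-A w))) z') z)
    (hread : ∀ z ∈ closedBall (0 : BlockChartSU N b) S, v (expFibreChartSU b c z) = U z)
    (hUL : ∀ z z' : BlockChartSU N b, U z - U z' ≤ L * ‖z - z'‖)
    (hUc : U 0 ≤ σ * θ)
    (hclause : 16 * (3 * B₃ * M₀ * A₀ ^ 2 * p₀g ^ 2 * Real.exp (-Rk) * (100 * (M : ℝ)) ^ 4 +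
        (WV + b.card * ((N * N : ℕ) * (-2 * Real.log (Real.sinc S))))) * P.d
      * (100 * (M : ℝ)) ^ (P.d + 1) * (dimSU N * L ^ 2) ≤ γ₀ * (θ * (1 - ρ - σ)) ^ 2)
    (henv : ∀ l ∈ Icc (1 - 1 / ((b.card : ℝ) * dimSU N + 1)) 1, ∀ z : BlockChartSU N b,
      θ * (1 - ρ) ≤ U z → U z < θ → z ∈ C → l • z ∈ Env)
    (hRT : ∀ z : BlockChartSU N b, θ * (1 - ρ) ≤ U z → U z < θ → z ∈ C → ∀ s' : ℝ, 1 ≤ s' →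
      θ * (1 - ρ) ≤ U (s' • z) → U (s' • z) < θ → s' • z ∈ C → U z + κ₀ * (θ * (1 - ρ)) * (s' - 1) ≤ U (s' • z))
    (hQ : ((volume : Measure (BlockChartSU N b)).withDensity fun z =>
        chartWeightSU b S (expJacWeightSU (kappaSU N)) z * K₀.indicator (fun w => ENNReal.ofReal (Real.exp (-A w))) z)
          (Env \ ({z | U z < θ} ∩ C))
      ≤ ENNReal.ofReal Q * ((volume : Measure (BlockChartSU N b)).withDensity fun z =>
        chartWeightSU b S (expJacWeightSU (kappaSU N)) z * K₀.indicator (fun w => ENNReal.ofReal (Real.exp (-A w))) z)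
          ({z | U z < θ} ∩ C))
    (hD : 3 * ((b.card : ℝ) * dimSU N + 1) * (1 + Q) / (κ₀ * (1 - ρ)) ≤ DK) :
    ∃ (S' : ℝ) (c' : GaugeField P j (SU N)) (R' : (↥b → SU N) → ℝ≥0∞) (U' : BlockChartSU N b → ℝ)
      (A' : Set (BlockChartSU N b)) (f : BlockChartSU N b → ℝ≥0∞) (D : ℝ),
      0 ≤ S' ∧ S' ≤ Real.pi ∧ Measurable R' ∧
      μ = (blockLaw b).withDensity (fun y => windowSU b c' S' y * R' y) ∧
      MeasurableSet A' ∧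
      (∀ z ∈ closedBall (0 : BlockChartSU N b) S', v (expFibreChartSU b c' z) = U' z) ∧
      ((fun z : BlockChartSU N b => chartWeightSU b S' (expJacWeightSU (kappaSU N)) z * R' (expFibreChartSU b c' z))
        =ᵐ[volume] A'.indicator f) ∧
      SlotAntiConcentration (((volume : Measure (BlockChartSU N b)).withDensity f).restrict A') U' θ ρ D ∧
      D ≤ DK := by
  exact chartPackage_of_sect1Letters_analyticLocal hN b hb μ hS hSπ c hRm hlaw v K₀ A Qf lin Vt hAm hUm hC hEnv hθ hρ0 hρ1 hρσ hκ hQ0 hL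
    hd (by exact_mod_cast (hM : 0 < M)) hγ₀ hr hW hK₀ h0K₀ hexp Mq hQf
    (ineq19_blockChartSU_of_ineq17_torus hwrap M hd hsides hM b hbox hcomb Qf hγ₀.le Sp hSp h17 hsmall)
    ℓ hlin h16 hV Φ hVt hΦd hΦS hclause₂ hR hread hUL hUc hclause henv hRT hQ hD

end Summit.QuantumFields.YangMills.Theorems.N21LowCentreEndAtSUNBlockChartPackageCoerciveTorusComb

end
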